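import Mathlib
import HarnessLib
import Literature.MathematicalPhysics.StatisticalMechanics.TorusFRDHolds
import Literature.MathematicalPhysics.StatisticalMechanics.GaussianWeightStepRenorm

/-!
# Fourier-multiplier matrices on the discrete torus: functional calculus through the multiplier
# (Buchholz, §2/App. A; Adams–Buchholz–Kotecký–Müller, Remark 7.4)

Every translation-invariant operator of the gradient renormalisation group on `(ℤ/M)^d` — the
difference operators `(∇^α)^*∇^α`, the Laplacian, the finite-range covariances `𝒞_k`, the operators
`M_k` and the dominating forms of [ABKM19] Lemma 7.3/7.5 — is "diagonal in Fourier space": it is the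
convolution with a multiplier kernel `mulKernel m` (`TorusFRDKernels.lean`), i.e. the circulant matrix

  `mulMat m = Matrix.circulant (mulKernel m)`,   `(mulMat m φ)^(κ) = m(κ) φ̂(κ)`.

[ABKM19] Remark 7.4: "All operators are diagonal in the Fourier space. Thus it is sufficient to show
the bound for all Fourier modes".  This file makes that reduction available for real even multipliers:

* algebra: `mulMat_mul`, `mulMat_one`, `mulMat_add`, `mulMat_sub`, `mulMat_smul`, `commute_mulMat`,
  `mulMat_inv` (`(mulMat m)⁻¹ = mulMat m⁻¹` for nowhere-vanishing `m`), `transpose_mulMat`;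
* order: `dotProduct_mulMat_mulVec` (`(φ, mulMat m φ) = M^{-d} Σ_κ m(κ)|φ̂(κ)|²`),
  `posSemidef_mulMat` (`m ≥ 0`), `posDef_mulMat` (`m > 0`), `posSemidef_mulMat_sub` (`a ≤ b ⇒
  mulMat a ⪯ mulMat b`: MATRIX INEQUALITIES FROM SCALAR ONES);
* functional calculus: `sqrt_mulMat` (`CFC.sqrt (mulMat m) = mulMat √m`),
  `one_sub_sqrt_mul_mul_sqrt_mulMat`, and the Gaussian weight step of [ABKM19] (7.5) on multipliers:
  **`nextForm_mulMat`** — `nextForm (mulMat a) (mulMat c) = mulMat (a/(1 − c a))` for `c ≥ 0`,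
  `c a < 1` (the scalar form `(a⁻¹ − c)⁻¹` of Lemma 7.3's heuristics);
* `trace_mulMat` — `tr (mulMat m) = Σ_κ m(κ)` (for the trace of Lemma 7.7).

Everything is proved; no named fact.

## References
* S. Buchholz, J. Funct. Anal. 275 (2018), §2 (2.14)–(2.19), App. A [Buchholz2016].
* S. Adams, S. Buchholz, R. Kotecký, S. Müller, arXiv:1910.13564, Remark 7.4, Lemma 7.3, (7.5)
  [AdamsBuchholzKoteckyMuller2019].
-/

noncomputable section

namespace Literature.MathematicalPhysics.StatisticalMechanics.GradientFRD

open Finset Matrix Literature.Probability.LatticeModels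
open scoped BigOperators MatrixOrder

variable {d M : ℕ} [NeZero M]

/-- **The multiplier matrix** `mulMat m = circulant (mulKernel m)`: the translation-invariant operator
with Fourier multiplier `m` ([ABKM19] Remark 7.4: "diagonal in Fourier space").
[cite: AdamsBuchholzKoteckyMuller2019, Remark 7.4] -/
def mulMat (m : (Fin d → ZMod M) → ℝ) : Matrix (Fin d → ZMod M) (Fin d → ZMod M) ℝ :=
  Matrix.circulant (mulKernel m)

/-! ## Action and Fourier coefficients -/

/-- `mulMat m φ = mulKernel m ⋆ φ`. [cite: Buchholz2016, §2 (2.17)] -/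
theorem mulMat_mulVec (m φ : (Fin d → ZMod M) → ℝ) : mulMat m *ᵥ φ = conv (mulKernel m) φ := by
  funext x
  simp [mulMat, Matrix.mulVec, dotProduct, Matrix.circulant_apply, conv]

/-- **`(mulMat m φ)^ = m · φ̂`** for an even multiplier. [cite: Buchholz2016, §2 (2.17)] -/
theorem fourierCoeff_mulMat_mulVec {m : (Fin d → ZMod M) → ℝ} (hm : ∀ κ, m (-κ) = m κ)
    (φ : (Fin d → ZMod M) → ℝ) (κ : Fin d → ZMod M) :
    fourierCoeff (mulMat m *ᵥ φ) κ = m κ * fourierCoeff φ κ := by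
  rw [mulMat_mulVec, fourierCoeff_conv, fourierCoeff_mulKernel hm]

omit [NeZero M] in
/-- Two matrices with the same action are equal (plumbing). [folklore] -/
private theorem ext_of_mulVec [NeZero M] {A B : Matrix (Fin d → ZMod M) (Fin d → ZMod M) ℝ}
    (h : ∀ φ, A *ᵥ φ = B *ᵥ φ) : A = B := by
  ext i j
  have := congrFun (h (Pi.single j 1)) i
  simpa [Matrix.mulVec_single_one] using this

/-- The Fourier coefficients of the zero field vanish. [cite: Buchholz2016, §2 (2.14)] -/
theorem fourierCoeff_zero_fun (κ : Fin d → ZMod M) : fourierCoeff (0 : (Fin d → ZMod M) → ℝ) κ = 0 := by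
  rw [fourierCoeff_eq_sum]
  simp

/-! ## Algebra of multiplier matrices -/

/-- **Products multiply multipliers**: `mulMat a · mulMat b = mulMat (a b)`.
[cite: Buchholz2016, §2 (2.17)] -/
theorem mulMat_mul {a b : (Fin d → ZMod M) → ℝ} (ha : ∀ κ, a (-κ) = a κ) (hb : ∀ κ, b (-κ) = b κ) :
    mulMat a * mulMat b = mulMat (fun κ => a κ * b κ) := by
  refine ext_of_mulVec fun φ => eq_of_fourierCoeff_eq fun κ => ?_
  rw [← Matrix.mulVec_mulVec, fourierCoeff_mulMat_mulVec ha, fourierCoeff_mulMat_mulVec hb,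
    fourierCoeff_mulMat_mulVec (fun κ => by rw [ha, hb])]
  push_cast
  ring

/-- `mulMat 1 = 1`. [cite: Buchholz2016, §2 (2.15)] -/
theorem mulMat_one : mulMat (fun _ : Fin d → ZMod M => (1 : ℝ)) = 1 := by
  refine ext_of_mulVec fun φ => eq_of_fourierCoeff_eq fun κ => ?_
  rw [fourierCoeff_mulMat_mulVec (fun _ => rfl), Matrix.one_mulVec]
  push_cast
  ring

/-- Additivity of the kernel in the multiplier. [cite: Buchholz2016, §2 (2.15)] -/
theorem mulKernel_add' (a b : (Fin d → ZMod M) → ℝ) (x : Fin d → ZMod M) :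
    mulKernel (fun κ => a κ + b κ) x = mulKernel a x + mulKernel b x := by
  simp only [mulKernel, mulSum, ← Complex.add_re, ← mul_add, ← sum_add_distrib]
  congr 2
  refine sum_congr rfl fun κ _ => ?_
  push_cast; ring

/-- `mulMat (a + b) = mulMat a + mulMat b`. [cite: Buchholz2016, §2 (2.15)] -/
theorem mulMat_add (a b : (Fin d → ZMod M) → ℝ) :
    mulMat (fun κ => a κ + b κ) = mulMat a + mulMat b := by
  ext i j
  simp [mulMat, Matrix.circulant_apply, mulKernel_add']

/-- `mulMat (c a) = c • mulMat a`. [cite: Buchholz2016, §2 (2.15)] -/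
theorem mulMat_smul (c : ℝ) (a : (Fin d → ZMod M) → ℝ) :
    mulMat (fun κ => c * a κ) = c • mulMat a := by
  ext i j
  simp [mulMat, Matrix.circulant_apply, mulKernel_const_mul]

/-- `mulMat (a − b) = mulMat a − mulMat b`. [cite: Buchholz2016, §2 (2.15)] -/
theorem mulMat_sub (a b : (Fin d → ZMod M) → ℝ) :
    mulMat (fun κ => a κ - b κ) = mulMat a - mulMat b := by
  have h : mulMat (fun κ => a κ - b κ) + mulMat b = mulMat a := by
    rw [← mulMat_add]
    congr 1; funext κ; ring
  rw [← h, add_sub_cancel_right]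

/-- Multiplier matrices commute. [cite: AdamsBuchholzKoteckyMuller2019, Remark 7.4] -/
theorem commute_mulMat {a b : (Fin d → ZMod M) → ℝ} (ha : ∀ κ, a (-κ) = a κ) (hb : ∀ κ, b (-κ) = b κ) :
    Commute (mulMat a) (mulMat b) := by
  rw [Commute, SemiconjBy, mulMat_mul ha hb, mulMat_mul hb ha]
  congr 1; funext κ; ring

/-- Multiplier matrices are symmetric (the kernel is even). [cite: Buchholz2016, Thm 2.4 (M_k(x) = M_k(−x))] -/
theorem transpose_mulMat (m : (Fin d → ZMod M) → ℝ) : (mulMat m)ᵀ = mulMat m := by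
  rw [mulMat, Matrix.transpose_circulant]
  congr 1
  funext x
  exact mulKernel_neg m x

/-- Multiplier matrices are symmetric. [cite: Buchholz2016, Thm 2.4] -/
theorem isSymm_mulMat (m : (Fin d → ZMod M) → ℝ) : (mulMat m).IsSymm := transpose_mulMat m

/-- **The inverse of a nowhere-vanishing multiplier**: `(mulMat m)⁻¹ = mulMat m⁻¹`.
[cite: AdamsBuchholzKoteckyMuller2019, Remark 7.4] -/
theorem mulMat_inv {m : (Fin d → ZMod M) → ℝ} (hm : ∀ κ, m (-κ) = m κ) (h0 : ∀ κ, m κ ≠ 0) :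
    (mulMat m)⁻¹ = mulMat (fun κ => (m κ)⁻¹) := by
  refine Matrix.inv_eq_right_inv ?_
  rw [mulMat_mul hm (fun κ => by rw [hm]), ← mulMat_one]
  congr 1; funext κ; rw [mul_inv_cancel₀ (h0 κ)]

/-- `det (mulMat m)` is a unit for a nowhere-vanishing multiplier. [cite: AdamsBuchholzKoteckyMuller2019, Remark 7.4] -/
theorem isUnit_det_mulMat {m : (Fin d → ZMod M) → ℝ} (hm : ∀ κ, m (-κ) = m κ) (h0 : ∀ κ, m κ ≠ 0) :
    IsUnit (mulMat m).det := by
  have h : mulMat m * mulMat (fun κ => (m κ)⁻¹) = 1 := by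
    rw [mulMat_mul hm (fun κ => by rw [hm]), ← mulMat_one]
    congr 1; funext κ; rw [mul_inv_cancel₀ (h0 κ)]
  exact (Matrix.isUnit_iff_isUnit_det _).1 (IsUnit.of_mul_eq_one _ h)

/-! ## Order: matrix inequalities from multiplier inequalities -/

/-- **The quadratic form in Fourier variables**: `(φ, mulMat m φ) = M^{-d} Σ_κ m(κ) |φ̂(κ)|²`.
[cite: Buchholz2016, §1 (positivity via 𝓕)] -/
theorem dotProduct_mulMat_mulVec (m φ : (Fin d → ZMod M) → ℝ) :
    φ ⬝ᵥ mulMat m *ᵥ φ = (((M : ℝ) ^ d))⁻¹ * ∑ κ, m κ * ‖fourierCoeff φ κ‖ ^ 2 := by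
  rw [← sum_sum_mulKernel]
  simp only [dotProduct, mulMat, Matrix.mulVec, Matrix.circulant_apply, Finset.mul_sum]
  exact sum_congr rfl fun x _ => sum_congr rfl fun y _ => by ring

/-- **`m ≥ 0 ⇒ mulMat m ⪰ 0`.** [cite: Buchholz2016, Thm 2.4 (positivity)] -/
theorem posSemidef_mulMat {m : (Fin d → ZMod M) → ℝ} (hm : ∀ κ, 0 ≤ m κ) : (mulMat m).PosSemidef := by
  refine Matrix.PosSemidef.of_dotProduct_mulVec_nonneg
    (isHermitian_iff_isSymm.2 (isSymm_mulMat m)) fun φ => ?_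
  rw [star_trivial, dotProduct_mulMat_mulVec]
  exact mul_nonneg (by positivity) (sum_nonneg fun κ _ => mul_nonneg (hm κ) (sq_nonneg _))

/-- **`a ≤ b ⇒ mulMat a ⪯ mulMat b`** — operator inequalities on the torus follow from inequalities of
the Fourier multipliers ([ABKM19] Remark 7.4). [cite: AdamsBuchholzKoteckyMuller2019, Remark 7.4] -/
theorem posSemidef_mulMat_sub {a b : (Fin d → ZMod M) → ℝ} (hab : ∀ κ, a κ ≤ b κ) :
    (mulMat b - mulMat a).PosSemidef := by
  rw [← mulMat_sub]
  exact posSemidef_mulMat fun κ => sub_nonneg.2 (hab κ)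

/-- **`m > 0 ⇒ mulMat m ≻ 0`.** [cite: Buchholz2016, Thm 2.4 (positivity)] -/
theorem posDef_mulMat {m : (Fin d → ZMod M) → ℝ} (hm : ∀ κ, 0 < m κ) : (mulMat m).PosDef := by
  refine Matrix.PosDef.of_dotProduct_mulVec_pos (isHermitian_iff_isSymm.2 (isSymm_mulMat m))
    fun φ hφ => ?_
  rw [star_trivial, dotProduct_mulMat_mulVec]
  -- some Fourier coefficient of `φ ≠ 0` is non-zero
  obtain ⟨κ₀, hκ₀⟩ : ∃ κ, fourierCoeff φ κ ≠ 0 := by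
    by_contra h
    push Not at h
    exact hφ (eq_of_fourierCoeff_eq fun κ => by rw [h κ, fourierCoeff_zero_fun])
  have hMpos : (0 : ℝ) < (((M : ℝ) ^ d))⁻¹ :=
    inv_pos.2 (pow_pos (Nat.cast_pos.2 (Nat.pos_of_ne_zero (NeZero.ne M))) d)
  refine mul_pos hMpos (lt_of_lt_of_le ?_ (single_le_sum (fun κ _ =>
    mul_nonneg (hm κ).le (sq_nonneg _)) (mem_univ κ₀)))
  exact mul_pos (hm κ₀) (pow_pos (norm_pos_iff.2 hκ₀) 2)

/-- `a < b ⇒ mulMat b − mulMat a ≻ 0`. [cite: AdamsBuchholzKoteckyMuller2019, Remark 7.4] -/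
theorem posDef_mulMat_sub {a b : (Fin d → ZMod M) → ℝ} (hab : ∀ κ, a κ < b κ) :
    (mulMat b - mulMat a).PosDef := by
  rw [← mulMat_sub]
  exact posDef_mulMat fun κ => sub_pos.2 (hab κ)

/-! ## Functional calculus: square root, the residual form and the Gaussian weight step -/

/-- **`√(mulMat m) = mulMat √m`** for `m ≥ 0` even. [cite: AdamsBuchholzKoteckyMuller2019, Remark 7.4] -/
theorem sqrt_mulMat {m : (Fin d → ZMod M) → ℝ} (hm : ∀ κ, m (-κ) = m κ) (h0 : ∀ κ, 0 ≤ m κ) :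
    CFC.sqrt (mulMat m) = mulMat (fun κ => Real.sqrt (m κ)) := by
  have hev : ∀ κ, Real.sqrt (m (-κ)) = Real.sqrt (m κ) := fun κ => by rw [hm]
  refine CFC.sqrt_unique ?_ (Matrix.nonneg_iff_posSemidef.2 (posSemidef_mulMat fun κ => Real.sqrt_nonneg _))
  rw [mulMat_mul hev hev]
  congr 1; funext κ; exact Real.mul_self_sqrt (h0 κ)

/-- **Conjugation by the square root on multipliers**: `√(mulMat c) · mulMat a · √(mulMat c) = mulMat (c a)`
for `c ≥ 0`. [cite: AdamsBuchholzKoteckyMuller2019, Lemma 7.3 (Remark 7.4)] -/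
theorem sqrt_mul_mul_sqrt_mulMat {a c : (Fin d → ZMod M) → ℝ} (ha : ∀ κ, a (-κ) = a κ)
    (hc : ∀ κ, c (-κ) = c κ) (hc0 : ∀ κ, 0 ≤ c κ) :
    CFC.sqrt (mulMat c) * mulMat a * CFC.sqrt (mulMat c) = mulMat (fun κ => c κ * a κ) := by
  have hev : ∀ κ, Real.sqrt (c (-κ)) = Real.sqrt (c κ) := fun κ => by rw [hc]
  rw [sqrt_mulMat hc hc0, mulMat_mul hev ha, mulMat_mul (fun κ => by rw [hev, ha]) hev]
  congr 1; funext κ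
  show Real.sqrt (c κ) * a κ * Real.sqrt (c κ) = c κ * a κ
  have := Real.mul_self_sqrt (hc0 κ)
  linear_combination (a κ) * this

/-- **The residual form of the Gaussian step on multipliers**:
`1 − √(mulMat c) · mulMat a · √(mulMat c) = mulMat (1 − c a)` for `c ≥ 0`.
[cite: AdamsBuchholzKoteckyMuller2019, Lemma 7.3 (Remark 7.4)] -/
theorem one_sub_sqrt_mul_mul_sqrt_mulMat {a c : (Fin d → ZMod M) → ℝ} (ha : ∀ κ, a (-κ) = a κ)
    (hc : ∀ κ, c (-κ) = c κ) (hc0 : ∀ κ, 0 ≤ c κ) :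
    (1 : Matrix _ _ ℝ) - CFC.sqrt (mulMat c) * mulMat a * CFC.sqrt (mulMat c) =
      mulMat (fun κ => 1 - c κ * a κ) := by
  rw [sqrt_mul_mul_sqrt_mulMat ha hc hc0, ← mulMat_one, ← mulMat_sub]

/-- Subcriticality on multipliers: `c a < 1 ⇒ 1 − √C A √C ≻ 0` for `C = mulMat c`, `A = mulMat a`.
[cite: AdamsBuchholzKoteckyMuller2019, Lemma 7.3 (Remark 7.4)] -/
theorem posDef_one_sub_sqrt_mul_mul_sqrt_mulMat {a c : (Fin d → ZMod M) → ℝ} (ha : ∀ κ, a (-κ) = a κ)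
    (hc : ∀ κ, c (-κ) = c κ) (hc0 : ∀ κ, 0 ≤ c κ) (hsub : ∀ κ, c κ * a κ < 1) :
    ((1 : Matrix _ _ ℝ) - CFC.sqrt (mulMat c) * mulMat a * CFC.sqrt (mulMat c)).PosDef := by
  rw [one_sub_sqrt_mul_mul_sqrt_mulMat ha hc hc0]
  exact posDef_mulMat fun κ => sub_pos.2 (hsub κ)

/-- A margin on multipliers: `c a ≤ θ ⇒ θ·1 − √C A √C ⪰ 0`.
[cite: AdamsBuchholzKoteckyMuller2019, Lemma 7.7 (7.71)] -/
theorem posSemidef_smul_one_sub_sqrt_mul_mul_sqrt_mulMat {a c : (Fin d → ZMod M) → ℝ}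
    (ha : ∀ κ, a (-κ) = a κ) (hc : ∀ κ, c (-κ) = c κ) (hc0 : ∀ κ, 0 ≤ c κ) {θ : ℝ}
    (hθ : ∀ κ, c κ * a κ ≤ θ) :
    (θ • (1 : Matrix _ _ ℝ) - CFC.sqrt (mulMat c) * mulMat a * CFC.sqrt (mulMat c)).PosSemidef := by
  have h2 : θ • (1 : Matrix (Fin d → ZMod M) (Fin d → ZMod M) ℝ) = mulMat (fun _ => θ * 1) := by
    rw [mulMat_smul, mulMat_one]
  rw [sqrt_mul_mul_sqrt_mulMat ha hc hc0, h2, ← mulMat_sub]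
  exact posSemidef_mulMat fun κ => by linarith [hθ κ]

/-- **The Gaussian weight step on multipliers** ([ABKM19] (7.5) / Lemma 7.3 in Fourier variables):
for even `a`, `c` with `c ≥ 0` and `c a < 1`,
`nextForm (mulMat a) (mulMat c) = mulMat (a / (1 − c a))` (`= (a⁻¹ − c)⁻¹` where `a > 0`).
[cite: AdamsBuchholzKoteckyMuller2019, Lemma 7.3 (Remark 7.4)] -/
theorem nextForm_mulMat {a c : (Fin d → ZMod M) → ℝ} (ha : ∀ κ, a (-κ) = a κ) (hc : ∀ κ, c (-κ) = c κ)
    (hc0 : ∀ κ, 0 ≤ c κ) (hsub : ∀ κ, c κ * a κ < 1) :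
    GradientRG.nextForm (mulMat a) (mulMat c) = mulMat (fun κ => a κ / (1 - c κ * a κ)) := by
  have hR := posDef_one_sub_sqrt_mul_mul_sqrt_mulMat ha hc hc0 hsub
  rw [GradientRG.nextForm_eq_mul_inv_of_posDef (posSemidef_mulMat hc0) hR, mulMat_mul hc ha,
    ← mulMat_one, ← mulMat_sub, mulMat_inv (fun κ => by simp only [hc, ha])
      (fun κ => (sub_pos.2 (hsub κ)).ne'), mulMat_mul ha (fun κ => by simp only [hc, ha])]
  rfl

/-! ## Trace -/

/-- **`tr (mulMat m) = Σ_κ m(κ)`** (the diagonal of a multiplier matrix is the constant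
`mulKernel m 0 = M^{-d} Σ_κ m(κ)`). [cite: AdamsBuchholzKoteckyMuller2019, Lemma 7.7 (7.80)] -/
theorem trace_mulMat (m : (Fin d → ZMod M) → ℝ) : (mulMat m).trace = ∑ κ, m κ := by
  have hdiag : (mulMat m).trace = (Fintype.card (Fin d → ZMod M) : ℝ) * mulKernel m 0 := by
    simp [Matrix.trace, mulMat, Matrix.circulant_apply, sum_const, nsmul_eq_mul]
  have hker : (mulKernel m 0 : ℝ) = (((M : ℝ) ^ d))⁻¹ * ∑ κ, m κ := by
    have h : mulSum m 0 = ((((((M : ℝ) ^ d))⁻¹ * ∑ κ, m κ : ℝ)) : ℂ) := by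
      simp only [mulSum, torusChar_zero_right, mul_one]
      push_cast
      rfl
    rw [mulKernel, h, Complex.ofReal_re]
  have hcard : (Fintype.card (Fin d → ZMod M) : ℝ) = (M : ℝ) ^ d := by
    rw [Fintype.card_fun, ZMod.card, Fintype.card_fin]; push_cast; rfl
  have hM : ((M : ℝ) ^ d) ≠ 0 := pow_ne_zero _ (by exact_mod_cast (NeZero.ne M))
  rw [hdiag, hker, hcard, ← mul_assoc, mul_inv_cancel₀ hM, one_mul]

end Literature.MathematicalPhysics.StatisticalMechanics.GradientFRD

end
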